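import Summits.Parity.BatemanHorn.Theses.SelbergDelangeRigidity

/-!
# `LSDRealSegment` — the real-segment law forbids SPIKES of the un-capped weight (negative lemma)

Negative knowledge on the crux `Summit.Parity.BatemanHorn.Theses.SelbergDelangeRigidity.LSDRealSegment`
(stmt-Parity-9770), from the crux-triage r1 (triager 1) finding F0 (`Cruxes/LSDRealSegment/TRIAGE-r1-1.md`).

If the normalised sums `T_x = x⁻¹ · exp(c · log log x) · Σ_{n ≤ x} w^{e(n)}` converge (to anything), the LAST TERM
`x⁻¹ · exp(c · log log x) · w^{e(x)}` tends to `0`: `T_x − r_x T_{x−1}` is exactly that term for `x ≥ 2`, with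
`r_x = (x−1)/x · exp(c (log log x − log log (x−1))) → 1` (`omegaLaw_tendsto_lastTerm_zero`, generic in `e`, `c`, `w`).
Hence (`tendsto_term_zero_of_lsdRealSegment`) the crux implies `y^{Ω_f(x)} = o(x (log x)^{k(y−1)})` along EVERY
integer `x`, for every Bateman–Horn system and every `y ∈ (5/4, 7/4)`: no single polynomial value may carry the sum.
For a member `fᵢ` of degree `d ≥ 2` with a root in `ℤ_p`, `p < y^d` (e.g. `X² + 7`, `p = 2`: `181² + 7 = 2¹⁵` is, at
`y = 7/4`, `7.1×` the scale `x (log x)^{3/4}`), this is a p-adic Diophantine statement on that root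
(`[fᵢ(n)]_p ≤ n^{(1+o(1)) log p/log y}`, exponent `log 2/log(7/4) = 1.2386…` at `p = 2`), known in print only
INEFFECTIVELY, via the p-adic Thue–Siegel–Roth theorem (Ridout 1958; Bugeaud–Evertse–Győry, Acta Arith. 184 (2018),
Thm 2.1: `[f(x)]_S ≪ |f(x)|^{1/deg f + ε}`, optimal).  So every proof of the crux for such members must import a
Roth-type theorem, and every EFFECTIVE tail / small-prime estimate for the un-capped weight (Nair–Tenenbaum, Shiu,
fundamental lemma) must be applied to the small-prime-PEELED weight only.  (The capped sibling crux
`AlmostPrimeZeros.SystemLSDRealSegment` and all-linear systems are exempt.)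

* `tendsto_loglog_sub_loglog_pred`, `tendsto_lastTermRatio_one` — the correction factor `r_x → 1`;
* `omegaLaw_tendsto_lastTerm_zero` — the last-term lemma for the crux's literal sum shape (any exponent map `e`);
* `tendsto_term_zero_of_lsdRealSegment` — the consequence of the route decl itself.
-/

open Filter Finset
open scoped BigOperators Topology

namespace Summit.Parity.BatemanHorn.Theorems.LSDRealSegment.Negative

open Summit.Parity.BatemanHorn.Theses.SelbergDelangeRigidity

noncomputable section
/-- `log log x − log log (x − 1) → 0` along the naturals. [folklore] -/
theorem tendsto_loglog_sub_loglog_pred :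
    Tendsto (fun x : ℕ => Real.log (Real.log x) - Real.log (Real.log ((x : ℝ) - 1))) atTop (𝓝 0) := by
  have hup : Tendsto (fun x : ℕ => 1 / (((x : ℝ) - 1) * Real.log 2)) atTop (𝓝 0) := by
    have h1 : Tendsto (fun x : ℕ => ((x : ℝ) - 1) * Real.log 2) atTop atTop :=
      ((tendsto_natCast_atTop_atTop.atTop_add (tendsto_const_nhds (x := (-1 : ℝ)))).congr
        fun x => by ring).atTop_mul_const (Real.log_pos one_lt_two)
    refine h1.inv_tendsto_atTop.congr fun x => ?_
    simp [one_div]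
  refine squeeze_zero' ?_ ?_ hup
  · filter_upwards [eventually_ge_atTop 3] with x hx
    have hx' : (3 : ℝ) ≤ x := by exact_mod_cast hx
    have hl1 : Real.log 2 ≤ Real.log ((x : ℝ) - 1) := Real.log_le_log two_pos (by linarith)
    have hl2 : Real.log ((x : ℝ) - 1) ≤ Real.log x := Real.log_le_log (by linarith) (by linarith)
    have h2 : 0 < Real.log 2 := Real.log_pos one_lt_two
    exact sub_nonneg.2 (Real.log_le_log (by linarith) hl2)
  · filter_upwards [eventually_ge_atTop 3] with x hx
    have hx' : (3 : ℝ) ≤ x := by exact_mod_cast hx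
    have h2 : 0 < Real.log 2 := Real.log_pos one_lt_two
    have hl1 : Real.log 2 ≤ Real.log ((x : ℝ) - 1) := Real.log_le_log two_pos (by linarith)
    have hlpos : 0 < Real.log ((x : ℝ) - 1) := lt_of_lt_of_le h2 hl1
    have hxpos : 0 < Real.log x := lt_of_lt_of_le hlpos (Real.log_le_log (by linarith) (by linarith))
    have hx1 : 0 < (x : ℝ) - 1 := by linarith
    -- log(log x) − log(log(x−1)) = log (log x / log (x−1)) ≤ log x / log(x−1) − 1
    rw [← Real.log_div hxpos.ne' hlpos.ne']
    refine (Real.log_le_sub_one_of_pos (div_pos hxpos hlpos)).trans ?_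
    rw [div_sub_one hlpos.ne', div_le_div_iff₀ hlpos (mul_pos hx1 h2), one_mul]
    -- log x − log (x−1) = log (x/(x−1)) ≤ x/(x−1) − 1 = 1/(x−1)
    have hdiff : Real.log x - Real.log ((x : ℝ) - 1) ≤ 1 / ((x : ℝ) - 1) := by
      rw [← Real.log_div (by linarith) hx1.ne']
      refine (Real.log_le_sub_one_of_pos (div_pos (by linarith) hx1)).trans (le_of_eq ?_)
      field_simp
      ring
    calc (Real.log x - Real.log ((x : ℝ) - 1)) * (((x : ℝ) - 1) * Real.log 2)
        ≤ (1 / ((x : ℝ) - 1)) * (((x : ℝ) - 1) * Real.log 2) := by gcongr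
      _ = Real.log 2 := by field_simp
      _ ≤ Real.log ((x : ℝ) - 1) := hl1

/-- The correction factor `r_x = (x−1)/x · exp(c (log log x − log log (x−1))) → 1`. [folklore] -/
theorem tendsto_lastTermRatio_one (c : ℂ) :
    Tendsto (fun x : ℕ => (((x : ℝ) - 1 : ℝ) : ℂ) / (x : ℂ) *
      Complex.exp (c * ((Real.log (Real.log x) - Real.log (Real.log ((x : ℝ) - 1)) : ℝ) : ℂ))) atTop (𝓝 1) := by
  have h1 : Tendsto (fun x : ℕ => (((x : ℝ) - 1 : ℝ) : ℂ) / (x : ℂ)) atTop (𝓝 1) := by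
    have hr : Tendsto (fun x : ℕ => ((x : ℝ) - 1) / x) atTop (𝓝 1) := by
      have : Tendsto (fun x : ℕ => 1 - (x : ℝ)⁻¹) atTop (𝓝 (1 - 0)) :=
        tendsto_const_nhds.sub (tendsto_inv_atTop_nhds_zero_nat (𝕜 := ℝ))
      rw [sub_zero] at this
      refine this.congr' ?_
      filter_upwards [eventually_ne_atTop 0] with x hx
      have hx' : (x : ℝ) ≠ 0 := by exact_mod_cast hx
      field_simp
    have := (Complex.continuous_ofReal.tendsto 1).comp hr
    simpa [Function.comp_def, Complex.ofReal_div] using this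
  have h2 : Tendsto (fun x : ℕ => Complex.exp (c * ((Real.log (Real.log x) -
      Real.log (Real.log ((x : ℝ) - 1)) : ℝ) : ℂ))) atTop (𝓝 1) := by
    have h0 : Tendsto (fun x : ℕ => c * ((Real.log (Real.log x) -
        Real.log (Real.log ((x : ℝ) - 1)) : ℝ) : ℂ)) atTop (𝓝 (c * ((0 : ℝ) : ℂ))) :=
      tendsto_const_nhds.mul ((Complex.continuous_ofReal.tendsto 0).comp tendsto_loglog_sub_loglog_pred)
    have := (Complex.continuous_exp.tendsto _).comp h0
    simpa [Function.comp_def] using this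
  simpa using h1.mul h2

/-- **Last-term lemma.** If `x⁻¹ e^{c log log x} Σ_{n ≤ x} w^{e(n)} → L` then `x⁻¹ e^{c log log x} w^{e(x)} → 0`. [folklore] -/
theorem omegaLaw_tendsto_lastTerm_zero (e : ℕ → ℕ) (c w L : ℂ)
    (hT : Tendsto (fun x : ℕ => (x : ℂ)⁻¹ * Complex.exp (c * (Real.log (Real.log x) : ℂ)) *
      ∑ n ∈ Finset.range (x + 1), w ^ e n) atTop (𝓝 L)) :
    Tendsto (fun x : ℕ => (x : ℂ)⁻¹ * Complex.exp (c * (Real.log (Real.log x) : ℂ)) * w ^ e x) atTop (𝓝 0) := by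
  set T : ℕ → ℂ := fun x => (x : ℂ)⁻¹ * Complex.exp (c * (Real.log (Real.log x) : ℂ)) *
      ∑ n ∈ Finset.range (x + 1), w ^ e n with hTdef
  set r : ℕ → ℂ := fun x => (((x : ℝ) - 1 : ℝ) : ℂ) / (x : ℂ) *
      Complex.exp (c * ((Real.log (Real.log x) - Real.log (Real.log ((x : ℝ) - 1)) : ℝ) : ℂ)) with hrdef
  have hT' : Tendsto (fun x : ℕ => T (x - 1)) atTop (𝓝 L) := hT.comp (tendsto_sub_atTop_nat 1)
  have hr : Tendsto r atTop (𝓝 1) := tendsto_lastTermRatio_one c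
  have hlim : Tendsto (fun x : ℕ => T x - r x * T (x - 1)) atTop (𝓝 0) := by
    have := hT.sub (hr.mul hT')
    simpa using this
  refine hlim.congr' ?_
  filter_upwards [eventually_ge_atTop 2] with x hx
  -- the identity `T x − r x · T (x−1) = last term`, for `x ≥ 2`
  have hx0 : (x : ℂ) ≠ 0 := by exact_mod_cast (show x ≠ 0 by omega)
  have hx1 : (((x : ℝ) - 1 : ℝ) : ℂ) ≠ 0 := by
    have : (x : ℝ) - 1 ≠ 0 := by
      have : (2 : ℝ) ≤ x := by exact_mod_cast hx
      linarith
    exact_mod_cast this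
  have hcast : (((x - 1 : ℕ) : ℂ)) = (((x : ℝ) - 1 : ℝ) : ℂ) := by
    push_cast [Nat.cast_sub (by omega : 1 ≤ x)]
    ring
  have hcastR : ((x - 1 : ℕ) : ℝ) = (x : ℝ) - 1 := by
    push_cast [Nat.cast_sub (by omega : 1 ≤ x)]
    ring
  have hsum : ∑ n ∈ Finset.range (x + 1), w ^ e n = (∑ n ∈ Finset.range (x - 1 + 1), w ^ e n) + w ^ e x := by
    rw [show x - 1 + 1 = x by omega, Finset.sum_range_succ]
  have hexp : Complex.exp (c * (Real.log (Real.log x) : ℂ)) =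
      Complex.exp (c * ((Real.log (Real.log x) - Real.log (Real.log ((x : ℝ) - 1)) : ℝ) : ℂ)) *
        Complex.exp (c * (Real.log (Real.log ((x - 1 : ℕ) : ℝ)) : ℂ)) := by
    rw [← Complex.exp_add, hcastR]
    congr 1
    push_cast
    ring
  simp only [hTdef, hrdef]
  rw [hsum, hcast, hexp]
  field_simp
  ring

/-- **The crux forbids spikes.** `LSDRealSegment` implies that for every Bateman–Horn system
and every real `y ∈ (5/4, 7/4)` the single normalised term `x⁻¹ (log x)^{k(1−y)} y^{Ω_f(x)}` tends to `0` along the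
integers `x` — no polynomial value may carry the sum (cf. `181² + 7 = 2¹⁵`, where at `y = 7/4` one term is `7.1×` the
scale `x (log x)^{3/4}`). [folklore] -/
theorem tendsto_term_zero_of_lsdRealSegment (h : LSDRealSegment) {k : ℕ} {f : Fin k → Polynomial ℤ}
    (hf : Literature.NumberTheory.Sieve.IsBatemanHornSystem f) {y : ℝ} (hy : 5 / 4 < y) (hy' : y < 7 / 4) :
    Tendsto (fun x : ℕ => (x : ℂ)⁻¹ * Complex.exp ((k : ℂ) * (1 - (y : ℂ)) * (Real.log (Real.log x) : ℂ)) *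
      (y : ℂ) ^ (∑ i, ArithmeticFunction.cardFactors (((f i).eval (x : ℤ)).toNat))) atTop (𝓝 0) := by
  obtain ⟨Λ, -, -, hlaw⟩ := h k f hf
  have := omegaLaw_tendsto_lastTerm_zero (fun n => ∑ i, ArithmeticFunction.cardFactors (((f i).eval (n : ℤ)).toNat))
    ((k : ℂ) * (1 - (y : ℂ))) (y : ℂ) _ (by simpa only [mul_assoc] using hlaw y hy hy')
  simpa only [mul_assoc] using this

end

end Summit.Parity.BatemanHorn.Theorems.LSDRealSegment.Negative
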